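import Summits.QuantumFields.YangMills.Theorems.UnitScaleTiltProp7TrueLinLineBound
import Summits.QuantumFields.YangMills.Theorems.UnitScaleTiltProp7LineOfTransportedFamily
import Summits.QuantumFields.YangMills.Theorems.UnitScaleTiltProp7CovHodgeConstraint
import Literature.MathematicalPhysics.QuantumFieldTheory.Balaban1983to89.BlockAveragingTowerStraightTransportLocal
import HarnessLib

/-!
# Route `UnitScaleTilt`, crux K1 child «MinimiserStabilityRegPr» (stmt-QuantumFields-19200), line «route-R», growth side — THE STRAIGHT SEGMENT OF A SYMMETRIC
# (0.4) WORD: ITS TRANSPORTED LETTERS SUM TO `covWalkSum`, CONSECUTIVE LETTERS DIFFER BY THE TRANSPORTED LONGITUDINAL COVARIANT DIFFERENCE (EXACTLY), AND THE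
# SQUARED OSCILLATIONS OF ALL SEGMENTS OF A BLOCK SUM TO AT MOST `L²·Σ_b ‖(D_{U₀,μ_b}Y_{μ_b})(b₋)‖²`

Cell `ym3-torus`, twin width seat `ym-routeR-w1` (g3); row (w1-o1′) NAMED by the route-R lead `ym-ust-19200-p1` (g13, bus 2026-08-28T13:33:15Z, piece (i)).
THEOREMS ONLY (0 `def`, 0 `sorry`); `--supports stmt-QuantumFields-19200 --as helper`, count-neutral.  Sequel of `…Prop7WordCommutatorSplit` (the three-piece split
`C(F·S·F′⁻¹) = C(S) + …`).  YM₃ on T³ is a ladder rung (R3), not the Clay problem; nothing here claims stub S, row E′, the crux or the gap.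

WHY.  In the three-piece split of the second-order source of the symmetric average along a word `F·S·F′⁻¹`, piece (i) is the ordered commutator pair sum `C(S)`
of the letters of the STRAIGHT SEGMENT `S = [x, x + L e_μ]`, charged by ✓ `Prop7OrderedProductExpansion.norm_commSum_le_mass_mul_osc` with MASS × OSCILLATION,
`osc = Σ_t ‖Ã_{t+1} − Ã_t‖`.  Along a straight segment all letters carry the SAME component `Y_μ`, transported to the start of the segment by the background:
`Ã_t = U₀([x, x+te_μ])·Y(x+te_μ, μ)·U₀([x, x+te_μ])^*`, so consecutive letters differ by the transported LONGITUDINAL covariant difference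
`Ã_{t+1} − Ã_t = U₀([x,x+te_μ])·(U₀(x+te_μ, μ)·Y(x+(t+1)e_μ, μ)·U₀(x+te_μ, μ)^* − Y(x+te_μ, μ))·U₀([x,x+te_μ])^*` EXACTLY (no corner, no curvature): the
oscillation of the segment is an `ℓ¹` sum of `L − 1` covariant GRADIENT letters `(D_{U₀,μ}Y_μ)` ([Balaban1985BackgroundPropagators] (3.3)), its square is at most
`(L−1)·Σ‖D_{U₀,μ}Y_μ‖²` along the segment, and over the `L^d` segments of all coarse bonds the line bonds cover every fine bond exactly `L` times
(✓ `Prop7TrueLinLineBound.sum_coarse_offsets_shifts`), whence the block row `Σ_c Σ_r osc(c,r)² ≤ L²·Σ_b ‖(D_{U₀,μ_b}Y_{μ_b})(b₋)‖²` — the `μ = ν` diagonal of the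
covariant gradient form of ✓ `Prop7CovariantWeitzenbock.sum_covD_sq_le_curl_sq_add_divB_sq` (curl + divergence + `2da`·mass).

WHAT IS PROVED (ns `…Theorems.Prop7WordCommutatorSplitWalk`; any level `j`, any `SU(N)` background `U₀`, any bond field `Y`; the segment letter written out as
`Ã_t := ↑(holAt U₀ (walk x (replicate t (μ,true)))) · Y⟨shift_μ^t x, μ⟩ · (↑(holAt …))^*`).
* (§1 by name, not restated: ✓ `Prop7LineOfTransportedFamily.covWalkSum_walk_replicate_true` — `covWalkSum U₀ Y (walk x (replicate m (μ,true))) = Σ_{t<m} Ã_t`,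
  the segment part of the linearised average of record IS the letter sum; imported.)
* §2 `holAt_walk_replicate_true_succ'` (last bond split off), ★★ `segLetter_succ_sub` (the exact identity above), `norm_segLetter_succ_sub_le` (`‖Ã_{t+1} − Ã_t‖ ≤ ‖U₀Y′U₀^* − Y‖`, conjugation is isometric),
  `osc_segment_le` (`Σ_{t<m}‖Ã_{t+1} − Ã_t‖ ≤ Σ_{t<m}‖(D_{U₀,μ}Y_μ)(x + te_μ)‖`), `sq_osc_segment_le` (Cauchy–Schwarz: `osc² ≤ m·Σ_{t<m}‖D_{U₀,μ}Y_μ‖²`).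
* §3 `sq_sum_range_le`, ★★ `sum_sq_osc_segment_le` — over all coarse bonds `c` and offsets `r` (segments from the block sites `x_r = blockSite c₋ r`, ✓ `walkEnd_emb_stairWord_eq_blockSite`),
  `Σ_c Σ_r (Σ_{t<L−1}‖Ã_{t+1} − Ã_t‖)² ≤ L²·Σ_b ‖U₀(b)·Y(b + e_{μ_b}, μ_b)·U₀(b)^* − Y(b)‖²` (standing range `j + 1 ≤ m + K`).
* §4 `longDiff_eq_covD` — the dictionary to ✓ `Prop7CovariantWeitzenbock`'s letters: `U₀(b)·Y(b + e_{μ_b}, μ_b)·U₀(b)^* − Y(b) = covD (torusT P j) (unitsField (toUField U₀))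
  μ_b (Y_{μ_b}) b₋` (✓ `Prop7CovHodgeConstraint.covD_bg_apply`).
HONEST SCOPE.  One segment ∕ one level; exact identities, the triangle inequality and Cauchy–Schwarz; no curvature and no smallness enter; the leg pieces (ii) and
the odd cross term (iii) of the split are not here.

References: T. Bałaban, CMP 109 (1987) 249–301 [Balaban1987RG1] ((0.3)–(0.4) pp.252–253); CMP 99 (1985) 389–434 [Balaban1985BackgroundPropagators] ((3.3) p.390,
(3.43) p.398); CMP 98 (1985) 17–51 [Balaban1985Averaging] ((56)–(58) p.27).
-/

noncomputable section

open scoped BigOperators Matrix.Norms.L2Operator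

namespace Summit.QuantumFields.YangMills.Theorems.Prop7WordCommutatorSplitWalk

open Literature.MathematicalPhysics.QuantumFieldTheory.Balaban1983to89
open Finset T4Continuum BlockAveraging AveragingRT ExpMeanLog BlockAveragingEMLLinearised BlockAveragingEMLLinearisedBackground BlockAveragingEMLProp2
open BlockAveragingTowerStraightTransportLocal (holAt_walk_replicate_true_succ holAt_walk_replicate_true_add holAt_walk_replicate_true_one)
open Summit.QuantumFields.YangMills.Theorems.Prop7HolRatioPerStep (norm_coe_eq_one norm_star_coe_eq_one coe_star_mul_self coe_mul_star_self)
open Summit.QuantumFields.YangMills.Theorems.Prop7TrueLinLineBound (sum_coarse_offsets_shifts)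

variable {P : Params} {n : Type*} [Fintype n] [DecidableEq n] [Nonempty n] {j : ℕ}

/-! ## §1 (by name) The segment part of the linearised average is the sum of the transported letters

This is ✓ `Prop7LineOfTransportedFamily.covWalkSum_walk_replicate_true` (imported): the letters `Ã_t` below are exactly its summands. -/

/-! ## §2 Consecutive letters differ by the transported longitudinal covariant difference -/

/-- `U₀([x, x+(t+1)e_μ]) = U₀([x, x+te_μ])·U₀(x+te_μ, μ)` (last bond split off). [cite: Balaban1984PropagatorsI, (1.7) p.18] -/
theorem holAt_walk_replicate_true_succ' (U₀ : GaugeField P j (Matrix.specialUnitaryGroup n ℂ)) (x : Site P j) (μ : Fin P.d) (t : ℕ) :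
    holAt U₀ (walk x (List.replicate (t + 1) (μ, true)))
      = holAt U₀ (walk x (List.replicate t (μ, true))) * U₀ ⟨(fun z : Site P j => z.shift μ)^[t] x, μ⟩ := by
  rw [holAt_walk_replicate_true_add, holAt_walk_replicate_true_one]

/-- ★★ **THE EXACT IDENTITY**: `Ã_{t+1} − Ã_t = U₀([x,x+te_μ])·(U₀(x_t, μ)·Y(x_{t+1}, μ)·U₀(x_t, μ)^* − Y(x_t, μ))·U₀([x,x+te_μ])^*`, `x_t = x + te_μ` — consecutive
letters of a straight segment differ by the transported LONGITUDINAL covariant difference of the component `Y_μ` (no corner term). [cite: Balaban1985BackgroundPropagators, (3.3) p.390] -/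
theorem segLetter_succ_sub (U₀ : GaugeField P j (Matrix.specialUnitaryGroup n ℂ)) (Y : PBond P j → Matrix n n ℂ) (x : Site P j) (μ : Fin P.d) (t : ℕ) :
    ((holAt U₀ (walk x (List.replicate (t + 1) (μ, true))) : Matrix.specialUnitaryGroup n ℂ) : Matrix n n ℂ)
        * Y ⟨(fun z : Site P j => z.shift μ)^[t + 1] x, μ⟩
        * star ((holAt U₀ (walk x (List.replicate (t + 1) (μ, true))) : Matrix.specialUnitaryGroup n ℂ) : Matrix n n ℂ)
      - ((holAt U₀ (walk x (List.replicate t (μ, true))) : Matrix.specialUnitaryGroup n ℂ) : Matrix n n ℂ)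
        * Y ⟨(fun z : Site P j => z.shift μ)^[t] x, μ⟩
        * star ((holAt U₀ (walk x (List.replicate t (μ, true))) : Matrix.specialUnitaryGroup n ℂ) : Matrix n n ℂ)
      = ((holAt U₀ (walk x (List.replicate t (μ, true))) : Matrix.specialUnitaryGroup n ℂ) : Matrix n n ℂ)
        * (((U₀ ⟨(fun z : Site P j => z.shift μ)^[t] x, μ⟩ : Matrix.specialUnitaryGroup n ℂ) : Matrix n n ℂ)
              * Y ⟨((fun z : Site P j => z.shift μ)^[t] x).shift μ, μ⟩
              * star (((U₀ ⟨(fun z : Site P j => z.shift μ)^[t] x, μ⟩ : Matrix.specialUnitaryGroup n ℂ) : Matrix n n ℂ))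
            - Y ⟨(fun z : Site P j => z.shift μ)^[t] x, μ⟩)
        * star ((holAt U₀ (walk x (List.replicate t (μ, true))) : Matrix.specialUnitaryGroup n ℂ) : Matrix n n ℂ) := by
  rw [holAt_walk_replicate_true_succ', Submonoid.coe_mul, star_mul, Function.iterate_succ_apply']
  noncomm_ring

/-- `‖Ã_{t+1} − Ã_t‖ ≤ ‖U₀(x_t, μ)·Y(x_{t+1}, μ)·U₀(x_t, μ)^* − Y(x_t, μ)‖` — the letter oscillation is bounded by (indeed equals) the longitudinal covariant difference.
[cite: Balaban1985BackgroundPropagators, (3.3) p.390] -/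
theorem norm_segLetter_succ_sub_le (U₀ : GaugeField P j (Matrix.specialUnitaryGroup n ℂ)) (Y : PBond P j → Matrix n n ℂ) (x : Site P j) (μ : Fin P.d)
    (t : ℕ) :
    ‖((holAt U₀ (walk x (List.replicate (t + 1) (μ, true))) : Matrix.specialUnitaryGroup n ℂ) : Matrix n n ℂ)
        * Y ⟨(fun z : Site P j => z.shift μ)^[t + 1] x, μ⟩
        * star ((holAt U₀ (walk x (List.replicate (t + 1) (μ, true))) : Matrix.specialUnitaryGroup n ℂ) : Matrix n n ℂ)
      - ((holAt U₀ (walk x (List.replicate t (μ, true))) : Matrix.specialUnitaryGroup n ℂ) : Matrix n n ℂ)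
        * Y ⟨(fun z : Site P j => z.shift μ)^[t] x, μ⟩
        * star ((holAt U₀ (walk x (List.replicate t (μ, true))) : Matrix.specialUnitaryGroup n ℂ) : Matrix n n ℂ)‖
      ≤ ‖((U₀ ⟨(fun z : Site P j => z.shift μ)^[t] x, μ⟩ : Matrix.specialUnitaryGroup n ℂ) : Matrix n n ℂ)
            * Y ⟨((fun z : Site P j => z.shift μ)^[t] x).shift μ, μ⟩
            * star (((U₀ ⟨(fun z : Site P j => z.shift μ)^[t] x, μ⟩ : Matrix.specialUnitaryGroup n ℂ) : Matrix n n ℂ))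
          - Y ⟨(fun z : Site P j => z.shift μ)^[t] x, μ⟩‖ := by
  rw [segLetter_succ_sub]
  -- conjugation by the `SU(N)` holonomy is isometric (`‖g‖ = ‖g^*‖ = 1`)
  calc _ ≤ ‖((holAt U₀ (walk x (List.replicate t (μ, true))) : Matrix.specialUnitaryGroup n ℂ) : Matrix n n ℂ)‖
        * ‖((U₀ ⟨(fun z : Site P j => z.shift μ)^[t] x, μ⟩ : Matrix.specialUnitaryGroup n ℂ) : Matrix n n ℂ)
              * Y ⟨((fun z : Site P j => z.shift μ)^[t] x).shift μ, μ⟩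
              * star (((U₀ ⟨(fun z : Site P j => z.shift μ)^[t] x, μ⟩ : Matrix.specialUnitaryGroup n ℂ) : Matrix n n ℂ))
            - Y ⟨(fun z : Site P j => z.shift μ)^[t] x, μ⟩‖
        * ‖star ((holAt U₀ (walk x (List.replicate t (μ, true))) : Matrix.specialUnitaryGroup n ℂ) : Matrix n n ℂ)‖ :=
        (norm_mul_le _ _).trans (mul_le_mul_of_nonneg_right (norm_mul_le _ _) (norm_nonneg _))
    _ = _ := by rw [norm_coe_eq_one, norm_star_coe_eq_one, one_mul, mul_one]

/-- **THE SEGMENT OSCILLATION IS AN `ℓ¹` SUM OF LONGITUDINAL COVARIANT DIFFERENCES**: `Σ_{t<m}‖Ã_{t+1} − Ã_t‖ ≤ Σ_{t<m}‖(D_{U₀,μ}Y_μ)(x + te_μ)‖`.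
[cite: Balaban1985BackgroundPropagators, (3.3) p.390, (3.43) p.398] -/
theorem osc_segment_le (U₀ : GaugeField P j (Matrix.specialUnitaryGroup n ℂ)) (Y : PBond P j → Matrix n n ℂ) (x : Site P j) (μ : Fin P.d) (m : ℕ) :
    ∑ t ∈ Finset.range m,
        ‖((holAt U₀ (walk x (List.replicate (t + 1) (μ, true))) : Matrix.specialUnitaryGroup n ℂ) : Matrix n n ℂ)
            * Y ⟨(fun z : Site P j => z.shift μ)^[t + 1] x, μ⟩
            * star ((holAt U₀ (walk x (List.replicate (t + 1) (μ, true))) : Matrix.specialUnitaryGroup n ℂ) : Matrix n n ℂ)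
          - ((holAt U₀ (walk x (List.replicate t (μ, true))) : Matrix.specialUnitaryGroup n ℂ) : Matrix n n ℂ)
            * Y ⟨(fun z : Site P j => z.shift μ)^[t] x, μ⟩
            * star ((holAt U₀ (walk x (List.replicate t (μ, true))) : Matrix.specialUnitaryGroup n ℂ) : Matrix n n ℂ)‖
      ≤ ∑ t ∈ Finset.range m,
          ‖((U₀ ⟨(fun z : Site P j => z.shift μ)^[t] x, μ⟩ : Matrix.specialUnitaryGroup n ℂ) : Matrix n n ℂ)
              * Y ⟨((fun z : Site P j => z.shift μ)^[t] x).shift μ, μ⟩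
              * star (((U₀ ⟨(fun z : Site P j => z.shift μ)^[t] x, μ⟩ : Matrix.specialUnitaryGroup n ℂ) : Matrix n n ℂ))
            - Y ⟨(fun z : Site P j => z.shift μ)^[t] x, μ⟩‖ :=
  Finset.sum_le_sum fun t _ => norm_segLetter_succ_sub_le U₀ Y x μ t

omit [Fintype n] [DecidableEq n] [Nonempty n] in
/-- Cauchy–Schwarz along the segment: `(Σ_{t<m} a_t)² ≤ m·Σ_{t<m} a_t²`. [folklore] -/
theorem sq_sum_range_le (m : ℕ) (a : ℕ → ℝ) :
    (∑ t ∈ Finset.range m, a t) ^ 2 ≤ (m : ℝ) * ∑ t ∈ Finset.range m, a t ^ 2 := by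
  have h := sq_sum_le_card_mul_sum_sq (s := Finset.range m) (f := a)
  rwa [Finset.card_range] at h

/-- **THE SQUARED OSCILLATION OF A SEGMENT**: `(Σ_{t<m}‖Ã_{t+1} − Ã_t‖)² ≤ m·Σ_{t<m}‖(D_{U₀,μ}Y_μ)(x + te_μ)‖²`. [cite: Balaban1985BackgroundPropagators, (3.43) p.398] -/
theorem sq_osc_segment_le (U₀ : GaugeField P j (Matrix.specialUnitaryGroup n ℂ)) (Y : PBond P j → Matrix n n ℂ) (x : Site P j) (μ : Fin P.d) (m : ℕ) :
    (∑ t ∈ Finset.range m,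
        ‖((holAt U₀ (walk x (List.replicate (t + 1) (μ, true))) : Matrix.specialUnitaryGroup n ℂ) : Matrix n n ℂ)
            * Y ⟨(fun z : Site P j => z.shift μ)^[t + 1] x, μ⟩
            * star ((holAt U₀ (walk x (List.replicate (t + 1) (μ, true))) : Matrix.specialUnitaryGroup n ℂ) : Matrix n n ℂ)
          - ((holAt U₀ (walk x (List.replicate t (μ, true))) : Matrix.specialUnitaryGroup n ℂ) : Matrix n n ℂ)
            * Y ⟨(fun z : Site P j => z.shift μ)^[t] x, μ⟩
            * star ((holAt U₀ (walk x (List.replicate t (μ, true))) : Matrix.specialUnitaryGroup n ℂ) : Matrix n n ℂ)‖) ^ 2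
      ≤ (m : ℝ) * ∑ t ∈ Finset.range m,
          ‖((U₀ ⟨(fun z : Site P j => z.shift μ)^[t] x, μ⟩ : Matrix.specialUnitaryGroup n ℂ) : Matrix n n ℂ)
              * Y ⟨((fun z : Site P j => z.shift μ)^[t] x).shift μ, μ⟩
              * star (((U₀ ⟨(fun z : Site P j => z.shift μ)^[t] x, μ⟩ : Matrix.specialUnitaryGroup n ℂ) : Matrix n n ℂ))
            - Y ⟨(fun z : Site P j => z.shift μ)^[t] x, μ⟩‖ ^ 2 := by
  have hosc := osc_segment_le U₀ Y x μ m
  have h0 : 0 ≤ ∑ t ∈ Finset.range m,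
        ‖((holAt U₀ (walk x (List.replicate (t + 1) (μ, true))) : Matrix.specialUnitaryGroup n ℂ) : Matrix n n ℂ)
            * Y ⟨(fun z : Site P j => z.shift μ)^[t + 1] x, μ⟩
            * star ((holAt U₀ (walk x (List.replicate (t + 1) (μ, true))) : Matrix.specialUnitaryGroup n ℂ) : Matrix n n ℂ)
          - ((holAt U₀ (walk x (List.replicate t (μ, true))) : Matrix.specialUnitaryGroup n ℂ) : Matrix n n ℂ)
            * Y ⟨(fun z : Site P j => z.shift μ)^[t] x, μ⟩
            * star ((holAt U₀ (walk x (List.replicate t (μ, true))) : Matrix.specialUnitaryGroup n ℂ) : Matrix n n ℂ)‖ :=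
    Finset.sum_nonneg fun _ _ => norm_nonneg _
  calc _ ≤ (∑ t ∈ Finset.range m,
          ‖((U₀ ⟨(fun z : Site P j => z.shift μ)^[t] x, μ⟩ : Matrix.specialUnitaryGroup n ℂ) : Matrix n n ℂ)
              * Y ⟨((fun z : Site P j => z.shift μ)^[t] x).shift μ, μ⟩
              * star (((U₀ ⟨(fun z : Site P j => z.shift μ)^[t] x, μ⟩ : Matrix.specialUnitaryGroup n ℂ) : Matrix n n ℂ))
            - Y ⟨(fun z : Site P j => z.shift μ)^[t] x, μ⟩‖) ^ 2 := pow_le_pow_left₀ h0 hosc 2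
    _ ≤ _ := sq_sum_range_le m _

/-! ## §3 Over all segments of a block: every fine bond is covered `L` times -/

/-- ★★ **THE BLOCK ROW**: summing the squared segment oscillations over all coarse bonds `c` and offsets `r` (segments of `L` letters from the block sites
`x_r = blockSite c₋ r`, `L − 1` consecutive differences each), `Σ_c Σ_r osc(c,r)² ≤ L²·Σ_b ‖U₀(b)·Y(b + e_{μ_b}, μ_b)·U₀(b)^* − Y(b)‖²` — `(L−1) ≤ L` from
Cauchy–Schwarz times the `L`-fold covering of the fine bonds by the line bonds (standing range). [cite: Balaban1984PropagatorsI, (1.11) p.19; Balaban1985BackgroundPropagators, (3.43) p.398] -/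
theorem sum_sq_osc_segment_le (hj : j + 1 ≤ P.m + P.K) (U₀ : GaugeField P j (Matrix.specialUnitaryGroup n ℂ)) (Y : PBond P j → Matrix n n ℂ) :
    ∑ c : PBond P (j + 1), ∑ r : Fin P.d → Fin P.L,
        (∑ t ∈ Finset.range (P.L - 1),
          ‖((holAt U₀ (walk (Site.blockSite c.src r) (List.replicate (t + 1) (c.dir, true))) : Matrix.specialUnitaryGroup n ℂ) : Matrix n n ℂ)
              * Y ⟨(fun z : Site P j => z.shift c.dir)^[t + 1] (Site.blockSite c.src r), c.dir⟩
              * star ((holAt U₀ (walk (Site.blockSite c.src r) (List.replicate (t + 1) (c.dir, true))) : Matrix.specialUnitaryGroup n ℂ) :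
                  Matrix n n ℂ)
            - ((holAt U₀ (walk (Site.blockSite c.src r) (List.replicate t (c.dir, true))) : Matrix.specialUnitaryGroup n ℂ) : Matrix n n ℂ)
              * Y ⟨(fun z : Site P j => z.shift c.dir)^[t] (Site.blockSite c.src r), c.dir⟩
              * star ((holAt U₀ (walk (Site.blockSite c.src r) (List.replicate t (c.dir, true))) : Matrix.specialUnitaryGroup n ℂ) :
                  Matrix n n ℂ)‖) ^ 2
      ≤ (P.L : ℝ) ^ 2 * ∑ b : PBond P j,
          ‖((U₀ b : Matrix.specialUnitaryGroup n ℂ) : Matrix n n ℂ) * Y ⟨b.src.shift b.dir, b.dir⟩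
              * star ((U₀ b : Matrix.specialUnitaryGroup n ℂ) : Matrix n n ℂ) - Y b‖ ^ 2 := by
  -- the longitudinal-difference letter as a function of the fine bond
  set g : PBond P j → ℝ := fun b =>
    ‖((U₀ b : Matrix.specialUnitaryGroup n ℂ) : Matrix n n ℂ) * Y ⟨b.src.shift b.dir, b.dir⟩
        * star ((U₀ b : Matrix.specialUnitaryGroup n ℂ) : Matrix n n ℂ) - Y b‖ ^ 2 with hg
  have hg0 : ∀ b, 0 ≤ g b := fun b => by rw [hg]; positivity
  have hcover := sum_coarse_offsets_shifts hj g
  have hL1 : ((P.L - 1 : ℕ) : ℝ) ≤ (P.L : ℝ) := by exact_mod_cast Nat.sub_le P.L 1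
  -- per segment: Cauchy–Schwarz, `L − 1 ≤ L`, and `range (L−1) ⊆ range L`
  have hseg : ∀ (c : PBond P (j + 1)) (r : Fin P.d → Fin P.L),
      (∑ t ∈ Finset.range (P.L - 1),
          ‖((holAt U₀ (walk (Site.blockSite c.src r) (List.replicate (t + 1) (c.dir, true))) : Matrix.specialUnitaryGroup n ℂ) : Matrix n n ℂ)
              * Y ⟨(fun z : Site P j => z.shift c.dir)^[t + 1] (Site.blockSite c.src r), c.dir⟩
              * star ((holAt U₀ (walk (Site.blockSite c.src r) (List.replicate (t + 1) (c.dir, true))) : Matrix.specialUnitaryGroup n ℂ) :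
                  Matrix n n ℂ)
            - ((holAt U₀ (walk (Site.blockSite c.src r) (List.replicate t (c.dir, true))) : Matrix.specialUnitaryGroup n ℂ) : Matrix n n ℂ)
              * Y ⟨(fun z : Site P j => z.shift c.dir)^[t] (Site.blockSite c.src r), c.dir⟩
              * star ((holAt U₀ (walk (Site.blockSite c.src r) (List.replicate t (c.dir, true))) : Matrix.specialUnitaryGroup n ℂ) :
                  Matrix n n ℂ)‖) ^ 2
        ≤ (P.L : ℝ) * ∑ t ∈ Finset.range P.L, g ⟨(fun z : Site P j => z.shift c.dir)^[t] (Site.blockSite c.src r), c.dir⟩ := by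
    intro c r
    have h1 := sq_osc_segment_le U₀ Y (Site.blockSite c.src r) c.dir (P.L - 1)
    have h2 : ∑ t ∈ Finset.range (P.L - 1), g ⟨(fun z : Site P j => z.shift c.dir)^[t] (Site.blockSite c.src r), c.dir⟩
        ≤ ∑ t ∈ Finset.range P.L, g ⟨(fun z : Site P j => z.shift c.dir)^[t] (Site.blockSite c.src r), c.dir⟩ :=
      Finset.sum_le_sum_of_subset_of_nonneg (Finset.range_mono (Nat.sub_le P.L 1)) fun t _ _ => hg0 _
    have h3 : ∀ t : ℕ, g ⟨(fun z : Site P j => z.shift c.dir)^[t] (Site.blockSite c.src r), c.dir⟩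
        = ‖((U₀ ⟨(fun z : Site P j => z.shift c.dir)^[t] (Site.blockSite c.src r), c.dir⟩ : Matrix.specialUnitaryGroup n ℂ) : Matrix n n ℂ)
              * Y ⟨((fun z : Site P j => z.shift c.dir)^[t] (Site.blockSite c.src r)).shift c.dir, c.dir⟩
              * star (((U₀ ⟨(fun z : Site P j => z.shift c.dir)^[t] (Site.blockSite c.src r), c.dir⟩ : Matrix.specialUnitaryGroup n ℂ) :
                  Matrix n n ℂ))
            - Y ⟨(fun z : Site P j => z.shift c.dir)^[t] (Site.blockSite c.src r), c.dir⟩‖ ^ 2 := fun t => by rw [hg]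
    simp only [← h3] at h1
    have h4 : 0 ≤ ∑ t ∈ Finset.range (P.L - 1), g ⟨(fun z : Site P j => z.shift c.dir)^[t] (Site.blockSite c.src r), c.dir⟩ :=
      Finset.sum_nonneg fun _ _ => hg0 _
    have h5 : 0 ≤ ∑ t ∈ Finset.range P.L, g ⟨(fun z : Site P j => z.shift c.dir)^[t] (Site.blockSite c.src r), c.dir⟩ :=
      Finset.sum_nonneg fun _ _ => hg0 _
    calc _ ≤ ((P.L - 1 : ℕ) : ℝ) * ∑ t ∈ Finset.range (P.L - 1), g ⟨(fun z : Site P j => z.shift c.dir)^[t] (Site.blockSite c.src r), c.dir⟩ := h1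
      _ ≤ (P.L : ℝ) * ∑ t ∈ Finset.range P.L, g ⟨(fun z : Site P j => z.shift c.dir)^[t] (Site.blockSite c.src r), c.dir⟩ :=
          mul_le_mul hL1 h2 h4 (Nat.cast_nonneg _)
  calc _ ≤ ∑ c : PBond P (j + 1), ∑ r : Fin P.d → Fin P.L,
          (P.L : ℝ) * ∑ t ∈ Finset.range P.L, g ⟨(fun z : Site P j => z.shift c.dir)^[t] (Site.blockSite c.src r), c.dir⟩ :=
        Finset.sum_le_sum fun c _ => Finset.sum_le_sum fun r _ => hseg c r
    _ = (P.L : ℝ) * ((P.L : ℝ) * ∑ b : PBond P j, g b) := by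
        rw [← hcover, Finset.mul_sum]
        refine Finset.sum_congr rfl fun c _ => ?_
        rw [Finset.mul_sum]
    _ = (P.L : ℝ) ^ 2 * ∑ b : PBond P j, g b := by ring

/-! ## §4 Dictionary: the longitudinal letter is `covD` of [Balaban1985BackgroundPropagators] (3.3) in the tree's letters -/

/-- **`U₀(b)·Y(b + e_{μ_b}, μ_b)·U₀(b)^* − Y(b) = (D_{U₀,μ_b}Y_{μ_b})(b₋)`** in the letters of ✓ `Prop7CovariantWeitzenbock` ∕ ✓ `B9Eq39Adjoint.covD` on the torus with the
background read through `unitsField ∘ toUField` (✓ `Prop7CovHodgeConstraint.covD_bg_apply`): the block row of §3 is the `μ = ν` diagonal of the covariant gradient form.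
[cite: Balaban1985BackgroundPropagators, (3.3) p.390] -/
theorem longDiff_eq_covD {N : ℕ} [NeZero N] (U₀ : GaugeField P j (Matrix.specialUnitaryGroup (Fin N) ℂ)) (Y : PBond P j → Matrix (Fin N) (Fin N) ℂ)
    (b : PBond P j) :
    ((U₀ b : Matrix.specialUnitaryGroup (Fin N) ℂ) : Matrix (Fin N) (Fin N) ℂ) * Y ⟨b.src.shift b.dir, b.dir⟩
        * star ((U₀ b : Matrix.specialUnitaryGroup (Fin N) ℂ) : Matrix (Fin N) (Fin N) ℂ) - Y b
      = B9Eq39Adjoint.covD (B9TorusCalculus.torusT P j) (fun κ z => B10Eq27TorusAxialLog.unitsField (B10Eq27TorusAxialLog.toUField U₀) ⟨z, κ⟩) b.dir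
          (fun z => Y ⟨z, b.dir⟩) b.src := by
  rw [Prop7CovHodgeConstraint.covD_bg_apply]
  rfl

end Summit.QuantumFields.YangMills.Theorems.Prop7WordCommutatorSplitWalk

end
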